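import Mathlib
import HarnessLib
import Summits.NavierStokesRegularity.NavierStokesRegularity.Theorems.PoloidalWindowDoorLrcModEntirePlanarCurveRigidity
import Summits.NavierStokesRegularity.NavierStokesRegularity.Theorems.PoloidalWindowDoorLrcModEntireSheetFlattenTools

/-!
# Route `PoloidalWindowDoor`, item `LrcModEntire` (stmt-NavierStokesRegularity-20428), cell (Q4-sonic, straight, μ < 0) `stub_Q4sonicLineNeg`, case II —
# BRICK B-TWPc, ENDGAME: `k₁′ ≡ 0` ON THE UNIT-SPEED BASE WEB ⇒ CONTRADICTION (J1-tail + J2 + J3 of idea-crit-7 g12's joint-sufficiency list)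

Cell ns-regularity-ideate, stub-worker seat ns-poloidal-K2-p2 g18 under the LEAD of item 20428 (ns-poloidal-K2-p3 g17/g18);
`--supports stmt-NavierStokesRegularity-20428 --as helper`.  Memo `Cruxes/LrcModEntire/TOWER-CLOSES-port2g9.md` §D2 («`k_{τ₁}′ ≡ 0` ⇒ `Γ_{τ₁}` is a line or a circle
inside the `r`-tube of the line `Γ` ⇒ an `e`-parallel line ⇒ pinned — contradiction»), idea-crit-7 g12 2026-08-29T23:29:26Z (J1–J4).

Class-free, in the currency of T1/T5 (`…BaseWebArclength.exists_unitSpeed_graph`, `…FermiTimeWebAt.curved_timeWeb_at`): the unit-speed base web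
`Γ σ = φσ·e + g(φσ)·Je` (`φ` onto `ℝ`, Frenet law `Γ″ = k₁·rotJ Γ′`, `k₁` differentiable), the J3 implication «`k₁ ≡ 0` ⇒ `g` constant», and the LINE
lever's output «`g` is not constant».  Then `deriv k₁ ≡ 0` is impossible:

* `inner_baseWeb_e` — `⟪Γ σ, e⟫ = φ σ`;
* ★ `false_of_curvature_deriv_zero` — `k₁` is constant `= k₀` (`is_const_of_deriv_eq_zero`); by this seat's g16 `…PlanarCurveRigidity.line_or_circle_of_constant_curvature`
  either `k₀ = 0` — then J3 pins the web, contradicting the lever — or `Γ` is a CIRCLE `‖Γ σ − p‖ = |k₀|⁻¹` — then `φ σ = ⟪Γ σ, e⟫` is bounded, contradicting `φ` onto `ℝ`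
  (J2: an entire graph over the `e`-axis is not a circle).

WHAT THIS IS NOT: not a claim about Navier–Stokes regularity; closes nothing (the input `deriv k₁ ≡ 0` is the pole argument's output, port-2 g9's assembly);
items 20428 / 19708 / 27893 OPEN (bears_on LADDER-NS N0).
-/

noncomputable section

set_option linter.dupNamespace false
set_option linter.style.longLine false

namespace Summit.NavierStokesRegularity.NavierStokesRegularity.Theorems.PoloidalWindowDoorLrcModEntireBaseWebEndgame

open Set Function Filter Topology
open scoped RealInnerProductSpace InnerProductSpace ContDiff
open Summit.NavierStokesRegularity.NavierStokesRegularity.Theorems.PoloidalWindowDoorLrcModEntireSheetFlattenTools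
open Summit.NavierStokesRegularity.NavierStokesRegularity.Theorems.PoloidalWindowDoorLrcModEntireRidgeGlobalBranchODE
open Summit.NavierStokesRegularity.NavierStokesRegularity.Theorems.PoloidalWindowDoorLrcModEntireRidgeGlobalBranchFrame
open Summit.NavierStokesRegularity.NavierStokesRegularity.Theorems.PoloidalWindowDoorLrcModEntirePlanarCurveRigidity

/-- `⟪φ·e + n·Je, e⟫ = φ` for a horizontal unit vector `e`. -/
theorem inner_baseWeb_e {e : EuclideanSpace ℝ (Fin 3)} (he2 : e 2 = 0) (hun : ‖e‖ = 1) (a n : ℝ) :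
    ⟪a • e + n • Jvec e, e⟫ = a := by
  have hJ : Jvec e = rotJ e := rfl
  rw [inner_add_left, real_inner_smul_left, real_inner_smul_left, real_inner_self_eq_norm_sq, hun, hJ, (rotJ_facts he2 hun).2.2.2]
  ring

/-- ★ **`k₁′ ≡ 0` ON THE UNIT-SPEED BASE WEB IS IMPOSSIBLE** (J1-tail + J2 + J3).  See the module docstring. -/
theorem false_of_curvature_deriv_zero {e : EuclideanSpace ℝ (Fin 3)} (he2 : e 2 = 0) (hun : ‖e‖ = 1)
    {Γ : ℝ → EuclideanSpace ℝ (Fin 3)} {φ k₁ g : ℝ → ℝ} (hΓ : ContDiff ℝ 2 Γ) (hφsurj : Surjective φ)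
    (hΓφ : ∀ σ, Γ σ = φ σ • e + g (φ σ) • Jvec e) (hΓ2 : ∀ σ, Γ σ 2 = 0) (hΓunit : ∀ σ, ‖deriv Γ σ‖ = 1)
    (hfrenet : ∀ σ, deriv (deriv Γ) σ = k₁ σ • rotJ (deriv Γ σ))
    (hk₁d : Differentiable ℝ k₁) (hk₁' : ∀ σ, deriv k₁ σ = 0)
    (hJ3 : (∀ σ, k₁ σ = 0) → ∀ s, g s = g 0) (hunpin : ∃ s, g s ≠ g 0) : False := by
  -- `k₁` is constant
  set k₀ : ℝ := k₁ 0 with hk₀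
  have hconst : ∀ σ, k₁ σ = k₀ := fun σ => is_const_of_deriv_eq_zero hk₁d hk₁' σ 0
  have hfrenet₀ : ∀ σ, deriv (deriv Γ) σ = k₀ • rotJ (deriv Γ σ) := fun σ => by rw [← hconst σ]; exact hfrenet σ
  rcases line_or_circle_of_constant_curvature hΓ hΓ2 hΓunit hfrenet₀ with ⟨hk0, -⟩ | ⟨hk0, p, -, hcirc⟩
  · -- LINE: `k₁ ≡ 0` ⇒ J3 pins the base web
    obtain ⟨s, hs⟩ := hunpin
    exact hs (hJ3 (fun σ => by rw [hconst σ, hk0]) s)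
  · -- CIRCLE: `φ σ = ⟪Γ σ, e⟫` is bounded, but `φ` is onto `ℝ`
    have hbd : ∀ σ, |φ σ| ≤ ‖p‖ + |k₀|⁻¹ := by
      intro σ
      have h1 : φ σ = ⟪Γ σ, e⟫ := by rw [hΓφ σ, inner_baseWeb_e he2 hun]
      have h2 : |⟪Γ σ, e⟫| ≤ ‖Γ σ‖ := by
        have := abs_real_inner_le_norm (Γ σ) e; rwa [hun, mul_one] at this
      have h3 : ‖Γ σ‖ ≤ ‖p‖ + |k₀|⁻¹ := by
        have := norm_le_norm_add_norm_sub' (Γ σ) p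
        calc ‖Γ σ‖ ≤ ‖p‖ + ‖Γ σ - p‖ := by linarith [norm_sub_le_norm_add (Γ σ) p, norm_add_le (Γ σ - p) p, show Γ σ = (Γ σ - p) + p by abel]
          _ = ‖p‖ + |k₀|⁻¹ := by rw [hcirc σ]
      rw [h1]; exact h2.trans h3
    obtain ⟨σ, hσ⟩ := hφsurj (‖p‖ + |k₀|⁻¹ + 1)
    have := hbd σ
    rw [hσ, abs_of_pos (by positivity)] at this
    linarith

end Summit.NavierStokesRegularity.NavierStokesRegularity.Theorems.PoloidalWindowDoorLrcModEntireBaseWebEndgame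

end
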